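import Literature.MathematicalPhysics.QuantumFieldTheory.Balaban1983to89.B9Thm312PositivityAssembled

/-!
# `Balaban1983to89.B9Eq3120StepDelta1Pi` — T. Bałaban, *Propagators for lattice gauge theories in a background field*, Commun. Math. Phys.
**99** (1985) 389–434 [Balaban1985BackgroundPropagators], Sect. D, (3.117)–(3.120) pp. 419–420 and (3.130)/(3.138) pp. 421–423: THE `Δ′_π`
SUMMAND OF THE PERTURBATION STEP `G₀(Δ′_π + Δ⁽²⁾_π)` OF (3.138) MADE EXPLICIT AND FACTORED AS PRINT ESTIMATES IT — at p10's matrix level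
`Δ′_π = K − TᵀKT` (`T = 1 − DG′RD*`, `K` the matrix of the bond form `⟨A, ΔA⟩`), and for symmetric `Δ` (`Tᵀ = 1 − DRG′D*`):
`K − TᵀKT = (KD)·(G′RD*) + D·[(RG′)(D*K)T]`, hence `G₀Δ′_π = G₀·[(KD)(G′RD*)] + (G₀D)·[(RG′)(D*K)T] = 𝒢 ∘ 𝒯₁` with the EXPLICIT pair map
`𝒯₁ = ((KD)(G′RD*), (RG′)(D*K)T)` — «one of the three derivatives there has to be applied either to an expression on the right, or on the left, of
Δ′_π»: the outer `D` of the second summand is absorbed into the neighbouring `G₀` — and the majorant of `𝒯₁` from the letters: the two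
FIRST-ORDER GAUGE-VARIATION letters `KD`, `D*K` of the Hessian (by (3.117) these ARE the `J`-commutator forms, small by (3.36): «the error terms are
small because the function J = D*η⁻²Im ∂U is small»), the `λ`-letter `G′RD*` and `RG′` (Theorem 3.1 ∘ (3.49)) and `T`; whence r06 FILE 81's
END-TO-END positivity clause of Theorem 3.12 («Theorem 3.11 holds for G₁») with its two `Δ′_π` hypotheses (`h1`: a factorisation through SOME `𝒯₁`;
`hT1`: its majorant) DISCHARGED in favour of letters on explicit matrices; FILE 82 of the Sect. B–D programme of cell `lit-balaban`, seat r06 (B9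
fold owner); rows **B9.Eq3.130** ((3.130)–(3.131)), **B9.Eq3.138**, **B9.Thm3.12** (member cells; heads are the lead's word)

statement-level skeleton of published theorems with citation tags; proofs where landed; nothing here is a claim about the Yang–Mills mass gap

CITATION HEADER (lean-in-tree rule).  B9 = [Balaban1985BackgroundPropagators] (held `paper:balaban1985-cmp99-background-propagators`, journal
page = PDF page + 388; render `b2b-balaban-ref1/pages/1985-cmp99-background-propagators/…-p031-x2.png` READ AS AN IMAGE by this seat 2026-08-25,
text pages p0033–p0035 re-read).  p. 419 [PDF 31]: «Expanding the both sides of the identity according to (3.12), and comparing terms of the same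
order, we get the identities ⟨Dλ, J⟩ = 0, or D\*J = 0, ⟨A − Dλ, Δ(A − Dλ)⟩ = ⟨A, ΔA⟩ − ⟨i[λ(b₋), A(b)] − i[A(b), R_bλ(b₊)] − i[λ(b₋),(Dλ)(b)], J⟩.
(3.117) The last equality can be interpreted as almost invariance of the quadratic form, the error terms are small because the function J =
D\*η⁻² Im ∂U is small, if U satisfies the condition (3.36).»; «⟨A, Δ_πA⟩ = ⟨A − DG′RD\*A, Δ(A − DG′RD\*A)⟩. (3.119) … Let us now apply the second
identity (3.117) to the right-hand side of (3.119). It gives the equality ⟨A, Δ_πA⟩ = ⟨A, ΔA⟩ − ⟨i[(G′RD\*A)(b₋), A(b)] − i[A(b), R_b(G′RD\*A)(b₊)]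
− i[(G′RD\*A)(b₋), (DG′RD\*A)(b)]J⟩ = ⟨A, ΔA⟩ − ⟨A, Δ′_πA⟩. (3.120) The quadratic form Δ′_π is a small perturbation of Δ.»; p. 421 [PDF 33]: «Let
us denote for a moment the operator we have investigated in previous sections by G₀, i.e. G₀ = (Δ + DRD\* + Q\*aQ)⁻¹. From (3.120) we get G =
G₀(I − Δ′_πG₀)⁻¹ = Σ_{n=0}^∞ G₀(Δ′_πG₀)ⁿ. (3.130) It is easy to find estimates for the operator Δ′_π, using Theorem 3.1 and the inequality (3.49),
we have to be careful only with the third term in the definition (3.120) of Δ′_π. One of the three derivatives there has to be applied either to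
an expression on the right, or on the left, of Δ′_π.»; p. 423 [PDF 35]: «Similarly as in (3.130) we get G₁ = G₀(I − (Δ′_π + Δ⁽²⁾_π)G₀)⁻¹ =
Σ_{n=0}^∞ G₀((Δ′_π + Δ⁽²⁾_π)G₀)ⁿ. (3.138) … we have derivatives in the operator Δ′_π + Δ⁽²⁾_π which have to be applied either to the operator on
the right, or on the left … Theorem 3.12. If an external gauge field configuration U satisfies both regularity conditions (3.35), (3.36) for α₀
sufficiently small, then Theorems 3.3, 3.10, 3.11 hold for the propagators G, G₁ …».  [4] = [Balaban1984PropagatorsII] (2.52)–(2.55) p. 232,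
Lemma 2.1 (2.61) p. 234.  [5] = [Balaban1985Averaging] (149) p. 40.

WHAT IS PROVED (kernel; theorems only — 0 `def`, 0 named fact, 0 sorry).  Carriers: p10's Sect.-D matrix vocabulary (`B9SectDFP`: bond index type
`X`, site index type `n`, `T = tOp Δ Q a D = 1 − DG′RD*`, `Δ_π = piOp K Δ Q a D = TᵀKT` as (3.119) defines it, so that `Δ′_π = K − TᵀKT` by
(3.120)), r16's block norms (`B11SectG`) and the product norm of pub-balaban r1's `B9SectDSup`.
* §1 THE FACTORISATION (matrix algebra; `Δ` symmetric so that `Tᵀ = 1 − DRG′D*`, p10's `tOp_transpose`): **`sub_piOp_eq`** — `K − TᵀKT =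
  (KD)(G′RD*) + D·[(RG′D*)K·T]` for ANY `K`; `mul_sub_piOp_eq` — `G₀(K − TᵀKT) = G₀·[(KD)(G′RD*)] + (G₀D)·[(RG′D*)K·T]`; **`step1_factored`** — as
  linear maps `G₀Δ′_π = 𝒢 ∘ 𝒯₁` with `𝒢 := G₀ ⊕ G₀D` (`LinearMap.coprod`) and `𝒯₁ := ((KD)(G′RD*), (RG′D*)K·T)` (`LinearMap.prod`) — LITERALLY the
  hypothesis `h1` of r06 FILE 81 `B9Thm312PositivityAssembled.thm312_posDef_G1_assembled` (and of FILE 78 §3/§6), now a theorem with `𝒯₁` explicit.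
* §2 THE MAJORANT OF `𝒯₁` FROM THE LETTERS ([4] (2.52)–(2.55), abstract block norms `bX` on bond functions, `bP` on site functions):
  **`hasMaj_T1`** — `KD : bP → bX` with `c_J·m·e^{−δ₁d}` and `D*K : bX → bP` with `c_J′·m·e^{−δ₁d}` (the (3.117) letters, `m = Mα₀`), `G′RD* : bX → bP`
  with `B_We^{−δ₁d}`, `RG′ : bP → bP` with `B_Re^{−δ₁d}` (Theorem 3.1 ∘ (3.49)), `T : bX → bX` with `C_Te^{−δ₁d}` ⟹ `𝒯₁ : bX → bX × bP` has
  `[κ_P c_J B_W c + κ_P B_R(κ_X c_J′ C_T c)c]·m·e^{−(δ₁−σ)d}` (two compositions `hasMaj_comp_exp`, `hasMaj_prod`) — LITERALLY the shape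
  `c₁·(Mα₀)·e^{−δ_Td}` of FILE 81's hypothesis `hT1`.
* §3 `T1_matrix_eq` (the pair map of §1 IS §2's word in `mulVecLin (K * D)`, `mulVecLin (G′ * R * Dᵀ)`, `mulVecLin (R * G′)`, `mulVecLin (Dᵀ * K)`,
  `mulVecLin T`) and **`thm312_posDef_G1_step1`** — THEOREM 3.12's CLAUSE «THEOREM 3.11 HOLDS FOR G₁» END TO END with the `Δ′_π` step EXPLICIT:
  FILE 81's `thm312_posDef_G1_assembled` with `h1` DISCHARGED by §1 and `hT1` DERIVED by §2 from the letters `hJ1` (`K·D`), `hJt` (`Dᵀ·K`), `hW`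
  (`G′·R·Dᵀ`), `hRGp` (`R·G′`) and FILE 81's own `hT`; conclusions unchanged (`G1inv` invertible, `G₁ > 0`, `G1inv > 0`, the series (3.138) → `G₁` in
  the sup operator norm), smallness `Mα₀·D ≤ ½` with `D` explicit in the letter constants.

HONEST SCOPE / NOT CLAIMED.  (i) The CONTENT of (3.117)/(3.120) — that `K·D` and `D*·K` (the first-order gauge variation of the Hessian `K` of
the action (3.12)) are the `J`-commutator operators `λ ↦ ½(i[λ(b₋), ·] − i[·, R_bλ(b₊)])`-paired-with-`J`, hence of size `O(1)·Mα₀` under (3.36) —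
enters as the two LETTERS `hJ1`, `hJt` of printed exponential shape (any rate: the operators are local); at p10's matrix level `K` is an abstract
symmetric matrix and `J` is not a carrier object, so (3.117) itself is row B9.Eq3.117's (`B9Eq3117Current`, on the `B9Eq39Adjoint` lattice
calculus), not re-derived here.  (ii) The third term of (3.120) (three derivatives) is NOT isolated: the decomposition of §1 groups `TᵀKT − K` as
«(first-order letter) × λ-map» plus «D × [(RG′)(first-order letter)ᵀ T]», the second-order form `D*KD` of (3.117) staying inside `(D*K)·T = D*K −
(D*KD)(G′RD*)`; print's instruction (move one derivative onto the neighbouring `G₀`) is exactly the outer `D` of the second component.  (iii) As in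
FILES 78/80/81, ALL letters are between the sharp-block SUP norms `ofBlocks blk` of the real bond coordinates and one abstract site norm `bP`
(print's state norms carry `|D*A|`-terms and Hölder sizes, (3.131)/(3.43) — not modelled; cell GAPS C-pv21g2-1 / pub-balaban r1's
`SectD-sup-proof.md`: the honest currency for the `Δ′_π` step uniformly in the scales is the simultaneous sup ⊕ Hölder state of `B9SectDSup`;
here one finite lattice at a time, constants not print's `O(1)`; located, zero weight).  (iv) `R·G′·Dᵀ` (FILE 81's `hRG`) and `G′·R·Dᵀ` (`hW`) are
separate letters (no commutation of `R` and `G′` is used); `Δ` symmetric (`hΔ`) gives `Tᵀ`.  (v) Rates: letters at `δ₁`, `𝒯₁` at `δ₁ − σ`, FILE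
81 fed with `δ_T := δ₁ − σ` (`5σ ≤ δ₁`); constants explicit, unoptimised.  NOT summit progress.

v1.1 (r06 g29, APPEND-ONLY over v1 p395692 ✓8b79497499b2; every v1 declaration byte-identical): §4 `hasMaj_T1_src` — §2 with the SOURCE (state) norm `bC`
decoupled from the bond norm `bX` (so that `bC` may be pub-balaban r1's sup ⊕ Hölder state of `B9SectDSup`, the honest currency for the scales — C-pv21g2-1),
and **`thm312_G1_rightEntry_step1`** — FILE 78's `thm312_G1_rightEntry_concreteDelta2` (Theorem 3.12's right entries `G₁F` from a state norm) with
`Δ′_π := K − TᵀKT`, `h1` DISCHARGED (`step1_factored`) and `hT1` DERIVED (`hasMaj_T1_src`) from the (3.117) letters + λ-letters.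

RELATED IN THE TREE, NOT DUPLICATED (searched 2026-08-25: stems `*3120*` = NE9's `B9Eq3120DeltaPiPrimeForm*` (the form defect `π†Δπ − Δ` in the
`L²`/energy currency on the torus carriers — different carrier and norm, not imported), `*StepDelta*` = FILE 78 only, `lean search --decl` for `step1_factored`, `hasMaj_T1`, `StepDelta1`
= ∅; `sub_piOp` only in an unrelated `AlgebraicGeometry/Motives` file): p10 `B9SectDFP` (`piOp`, `tOp` — USED), `B9Delta2Def134` (`tOp_transpose` — USED), pub-balaban r1 `B9SectDSup` (`prodNorm`, `hasMaj_prod` —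
USED; its md Lemma 4.2 is the factored `Δ′_π` step this file types at matrix level), r16 `B11SectG` (USED), r06 FILE 78 `B9Eq3138StepDelta2Pi` (the
`Δ⁽²⁾_π` twin — pattern followed), FILE 81 `B9Thm312PositivityAssembled` (USED: `thm312_posDef_G1_assembled`), FILE 67 `B9Ineq3131Letters` ((3.131) at
the form level on `B9Eq39Adjoint`).  Unit `lit-balaban-r06`, HOME `run/shared/lean/pub/lit-balaban/`.
-/

noncomputable section

open scoped BigOperators Matrix

namespace Literature.MathematicalPhysics.QuantumFieldTheory.Balaban1983to89.B9Eq3120StepDelta1Pi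

open Literature.MathematicalPhysics.QuantumFieldTheory.Balaban1983to89
open B11SectG B6RandomWalk B9SectDSup

/-! ## §1 `K − TᵀKT = (KD)(G′RD*) + D·[(RG′D*)K·T]` and `G₀Δ′_π = 𝒢 ∘ 𝒯₁` -/

section Factorisation

variable {X n m : Type} [Fintype X] [Fintype n] [Fintype m] [DecidableEq X] [DecidableEq n] [DecidableEq m]

/-- **(3.120) regrouped**: for symmetric `Δ` (`Tᵀ = 1 − DRG′D*`, p10's `tOp_transpose`) and ANY bond form `K`,
`K − TᵀKT = (K·D)·(G′RD*) + D·[(RG′D*)·K·T]` — the first-order gauge variation `K·D` of the form against the `λ`-map `G′RD*`, plus an outer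
derivative `D` times `(RG′)(D*K)T`. [cite: Balaban1985BackgroundPropagators, (3.119)–(3.120) p.419, p.421 (after (3.130))] -/
theorem sub_piOp_eq (K : Matrix X X ℝ) (Δ : Matrix n n ℝ) (Q : Matrix m n ℝ) (a : ℝ) (D : Matrix X n ℝ) (hΔ : Δ.IsSymm) :
    K - B9SectDFP.piOp K Δ Q a D =
      K * D * (B9H163.G' Δ Q a * B9H163.R Δ Q a * Dᵀ) +
        D * (B9H163.R Δ Q a * B9H163.G' Δ Q a * Dᵀ * K * B9SectDFP.tOp Δ Q a D) := by
  rw [B9SectDFP.piOp, B9Delta2Def134.tOp_transpose Δ Q a D hΔ, B9SectDFP.tOp]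
  simp only [Matrix.sub_mul, Matrix.mul_sub, Matrix.one_mul, Matrix.mul_one, Matrix.mul_assoc]
  abel

/-- **the outer derivative goes to the left**: `G₀(K − TᵀKT) = G₀·[(KD)(G′RD*)] + (G₀D)·[(RG′D*)K·T]` for ANY `G₀`, `K`.
[cite: Balaban1985BackgroundPropagators, (3.120) p.419, p.421 (after (3.130)), p.423 (after (3.138))] -/
theorem mul_sub_piOp_eq (G₀ K : Matrix X X ℝ) (Δ : Matrix n n ℝ) (Q : Matrix m n ℝ) (a : ℝ) (D : Matrix X n ℝ) (hΔ : Δ.IsSymm) :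
    G₀ * (K - B9SectDFP.piOp K Δ Q a D) =
      G₀ * (K * D * (B9H163.G' Δ Q a * B9H163.R Δ Q a * Dᵀ)) +
        G₀ * D * (B9H163.R Δ Q a * B9H163.G' Δ Q a * Dᵀ * K * B9SectDFP.tOp Δ Q a D) := by
  rw [sub_piOp_eq K Δ Q a D hΔ, Matrix.mul_add, Matrix.mul_assoc G₀ D]

/-- **`G₀Δ′_π = 𝒢 ∘ 𝒯₁`** as linear maps (`Δ′_π = K − TᵀKT`): `𝒢(φ, ψ) = G₀φ + G₀Dψ` on pairs (bond configuration, site function) —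
`LinearMap.coprod` — and the EXPLICIT `𝒯₁f = ((KD)(G′RD*)f, (RG′D*)K·Tf)` — `LinearMap.prod`; literally the shape of the hypothesis `h1` of
`B9Thm312PositivityAssembled.thm312_posDef_G1_assembled` / `B9Eq3138StepDelta2Pi.rightEntry_G1_factored`.
[cite: Balaban1985BackgroundPropagators, (3.120) p.419, (3.130) p.421, (3.138) p.423] -/
theorem step1_factored (G0m K : Matrix X X ℝ) (Δ : Matrix n n ℝ) (Q : Matrix m n ℝ) (a : ℝ) (D : Matrix X n ℝ) (hΔ : Δ.IsSymm) :
    Matrix.mulVecLin G0m * Matrix.mulVecLin (K - B9SectDFP.piOp K Δ Q a D) =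
      ((Matrix.mulVecLin G0m).coprod (Matrix.mulVecLin (G0m * D))) ∘ₗ
        ((Matrix.mulVecLin (K * D * (B9H163.G' Δ Q a * B9H163.R Δ Q a * Dᵀ))).prod
          (Matrix.mulVecLin (B9H163.R Δ Q a * B9H163.G' Δ Q a * Dᵀ * K * B9SectDFP.tOp Δ Q a D))) := by
  rw [LinearMap.coprod_comp_prod, Module.End.mul_eq_comp, ← Matrix.mulVecLin_mul, mul_sub_piOp_eq G0m K Δ Q a D hΔ,
    Matrix.mulVecLin_add, Matrix.mulVecLin_mul, Matrix.mulVecLin_mul (G0m * D)]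

end Factorisation

/-! ## §2 The majorant of `𝒯₁ = ((KD)(G′RD*), (RG′)(D*K)T)` from the letters -/

section Letters

variable {g : B6.Geometry} {FX P : Type} [AddCommGroup FX] [Module ℝ FX] [AddCommGroup P] [Module ℝ P]
variable {bX : BlockNorm g FX} {bP : BlockNorm g P}

/-- **the `𝒯₁`-majorant from the letters** ([4] (2.52)–(2.55) + «a summation preserves it also»): the (3.117) letters `KD : bP → bX`
(`c_J·m·e^{−δ₁d}`) and `D*K : bX → bP` (`c_J′·m·e^{−δ₁d}`) — `m = Mα₀`, «the error terms are small because the function J … is small» —, the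
`λ`-letters `G′RD* : bX → bP` (`B_We^{−δ₁d}`) and `RG′ : bP → bP` (`B_Re^{−δ₁d}`) — «using Theorem 3.1 and the inequality (3.49)» — and `T : bX → bX`
(`C_Te^{−δ₁d}`) ⟹ the pair map `f ↦ ((KD)(G′RD*f), (RG′)((D*K)(Tf)))` into the product norm `bX × bP` has the majorant
`(κ_P c_J m B_W c + κ_P B_R (κ_X c_J′ m C_T c) c)·e^{−ρd}` for `ρ ≧ 0`, `σ ≧ 0`, `ρ + σ ≦ δ₁`.
[cite: Balaban1985BackgroundPropagators, (3.120) p.419, (3.130)–(3.131) pp.421–422] [cite: Balaban1984PropagatorsII, (2.52)–(2.55) p.232, (2.61) p.234] -/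
theorem hasMaj_T1 {J : P →ₗ[ℝ] FX} {W : FX →ₗ[ℝ] P} {RG : P →ₗ[ℝ] P} {Jt : FX →ₗ[ℝ] P} {Top : FX →ₗ[ℝ] FX}
    {cJ cJ' m BW BR CT δ₁ ρ σ c : ℝ}
    (htri : Triangle254 g) (hd : ∀ a b : g.Site, 0 ≤ g.dist a b) (hrow : RowSum g σ c)
    (hcJ : 0 ≤ cJ) (hcJ' : 0 ≤ cJ') (hm : 0 ≤ m) (hBW : 0 ≤ BW) (hBR : 0 ≤ BR) (hCT : 0 ≤ CT) (hρ : 0 ≤ ρ) (hσ : 0 ≤ σ)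
    (hρδ : ρ + σ ≤ δ₁)
    (hJ : HasMaj bP bX J (fun a b => cJ * m * Real.exp (-(δ₁ * g.dist a b))))
    (hJt : HasMaj bX bP Jt (fun a b => cJ' * m * Real.exp (-(δ₁ * g.dist a b))))
    (hW : HasMaj bX bP W (fun a b => BW * Real.exp (-(δ₁ * g.dist a b))))
    (hRG : HasMaj bP bP RG (fun a b => BR * Real.exp (-(δ₁ * g.dist a b))))
    (hT : HasMaj bX bX Top (fun a b => CT * Real.exp (-(δ₁ * g.dist a b)))) :
    HasMaj bX (prodNorm bX bP) ((J ∘ₗ W).prod (RG ∘ₗ (Jt ∘ₗ Top)))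
      (fun a b => (bP.κ * (cJ * m) * BW * c + bP.κ * BR * (bX.κ * (cJ' * m) * CT * c) * c) * Real.exp (-(ρ * g.dist a b))) := by
  have hc : 0 ≤ c ∨ IsEmpty g.Site := by
    by_cases hne : Nonempty g.Site
    · exact Or.inl (hrow.nonneg (Classical.arbitrary _))
    · exact Or.inr (not_nonempty_iff.mp hne)
  rcases hc with hc | hemp
  swap
  · intro y' μ hμ y
    exact (IsEmpty.false y).elim
  have hcJm : 0 ≤ cJ * m := mul_nonneg hcJ hm
  have hcJ'm : 0 ≤ cJ' * m := mul_nonneg hcJ' hm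
  -- first component `(KD)(G′RD*)` at the rate `ρ`
  have h1 : HasMaj bX bX (J ∘ₗ W) (fun a b => bP.κ * (cJ * m) * BW * c * Real.exp (-(ρ * g.dist a b))) :=
    hasMaj_comp_exp htri hd hrow hcJm hBW hρ (by linarith) hρδ hJ hW
  -- inner word `(D*K)T` of the second component at the rate `ρ` (it is re-used at `ρ` as the input of `RG′` at `δ₁ ≥ ρ + σ`)
  have h2 : HasMaj bX bP (Jt ∘ₗ Top) (fun a b => bX.κ * (cJ' * m) * CT * c * Real.exp (-(ρ * g.dist a b))) :=
    hasMaj_comp_exp htri hd hrow hcJ'm hCT hρ (by linarith) hρδ hJt hT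
  have h3 : HasMaj bX bP (RG ∘ₗ (Jt ∘ₗ Top))
      (fun a b => bP.κ * BR * (bX.κ * (cJ' * m) * CT * c) * c * Real.exp (-(ρ * g.dist a b))) :=
    hasMaj_comp_exp htri hd hrow hBR (mul_nonneg (mul_nonneg (mul_nonneg bX.κ_nonneg hcJ'm) hCT) hc) hρ le_rfl hρδ hRG h2
  exact (hasMaj_prod h1 h3).mono fun a b => le_of_eq (by ring)

/-- the same majorant displayed in FILE 81's shape `c₁·(Mα₀)·e^{−ρd}`, `c₁ = κ_P c_J B_W c + κ_P B_R κ_X c_J′ C_T c²`.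
[cite: Balaban1985BackgroundPropagators, (3.130)–(3.131) pp.421–422, (3.138) p.423] [cite: Balaban1984PropagatorsII, (2.52)–(2.55) p.232, (2.61) p.234] -/
theorem hasMaj_T1' {J : P →ₗ[ℝ] FX} {W : FX →ₗ[ℝ] P} {RG : P →ₗ[ℝ] P} {Jt : FX →ₗ[ℝ] P} {Top : FX →ₗ[ℝ] FX}
    {cJ cJ' m BW BR CT δ₁ ρ σ c : ℝ}
    (htri : Triangle254 g) (hd : ∀ a b : g.Site, 0 ≤ g.dist a b) (hrow : RowSum g σ c)
    (hcJ : 0 ≤ cJ) (hcJ' : 0 ≤ cJ') (hm : 0 ≤ m) (hBW : 0 ≤ BW) (hBR : 0 ≤ BR) (hCT : 0 ≤ CT) (hρ : 0 ≤ ρ) (hσ : 0 ≤ σ)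
    (hρδ : ρ + σ ≤ δ₁)
    (hJ : HasMaj bP bX J (fun a b => cJ * m * Real.exp (-(δ₁ * g.dist a b))))
    (hJt : HasMaj bX bP Jt (fun a b => cJ' * m * Real.exp (-(δ₁ * g.dist a b))))
    (hW : HasMaj bX bP W (fun a b => BW * Real.exp (-(δ₁ * g.dist a b))))
    (hRG : HasMaj bP bP RG (fun a b => BR * Real.exp (-(δ₁ * g.dist a b))))
    (hT : HasMaj bX bX Top (fun a b => CT * Real.exp (-(δ₁ * g.dist a b)))) :
    HasMaj bX (prodNorm bX bP) ((J ∘ₗ W).prod (RG ∘ₗ (Jt ∘ₗ Top)))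
      (fun a b => (bP.κ * cJ * BW * c + bP.κ * BR * bX.κ * cJ' * CT * c * c) * m * Real.exp (-(ρ * g.dist a b))) :=
  (hasMaj_T1 htri hd hrow hcJ hcJ' hm hBW hBR hCT hρ hσ hρδ hJ hJt hW hRG hT).mono fun a b => le_of_eq (by ring)

end Letters

/-! ## §3 Theorem 3.12's clause «Theorem 3.11 holds for G₁» with the `Δ′_π` step explicit -/

section Assembled

open NormedSpace Finset Metric Filter
open B7Prop1Explicit B7Prop1Local B7Prop2Explicit B7Prop3Flat B7Prop4Flat B7Eq92Concrete B7Prop3GeneralLinear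
  B7Prop4GeneralLevels B7Prop5GeneralOperators B7Prop5GeneralInduction B7Prop5GeneralLevels B7Ineq149Pairing B7Eq136SecondOrder
  B9Ineq3137From149 B9Eq3134MatrixConcrete

variable {d : ℕ}
variable {𝔸 : Type*} [NormedRing 𝔸] [NormedAlgebra ℂ 𝔸] [CompleteSpace 𝔸] [NormOneClass 𝔸]

variable (L : ℕ) (hL : 2 ≤ L) {G : Subgroup 𝔸ˣ} (hG : AvgClosed d L G) (k : ℕ)
  (U₀ : B7Prop1Explicit.Site d → Fin d → 𝔸ˣ) (hU₀ : ∀ x κ, U₀ x κ ∈ G) {α₀ : ℝ} (hα : 0 < α₀)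
  (hα3 : C0 d * α₀ ≤ 1 / 3) (hα4 : 4 * α₀ ≤ c2' d L) (h52 : pdev U₀ < α₀ * (((L : ℝ) ^ k)⁻¹) ^ 2)
  {b : ℝ} (hb : 0 < b)
  (hsmall : Real.exp (4 * (800 * ((d : ℝ) + 1) ^ 2 * ((d : ℝ) + 4)) * α₀)
    * (1 + 8 * (131072 * ((d : ℝ) + 1) ^ 2) * ((L : ℝ) ^ k * b)) ≤ 2)
  (hc₃ : 4 * ((L : ℝ) ^ k * b) < c3 d L)
  (h145 : 8 * d * thetaGen d L α₀ * (L : ℝ)⁻¹ ^ 4 ≤ 1)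
  (h155 : (2 * (L : ℝ) - 1) * (L : ℝ)⁻¹ ^ 2 + 2 * d * thetaGen d L α₀ * (L : ℝ)⁻¹ ^ 3
    + 1 / 8 * (1 + 2 * d * thetaGen d L α₀ * (L : ℝ)⁻¹ ^ 2 + 2 * d * C3Gen d L * ((L : ℝ) ^ k * b)) * (L : ℝ)⁻¹ ^ 2 ≤ 1)
  (S : Finset (B7Prop1Explicit.Site d × Fin d))
  (lv : Finset ℕ) (T : ℕ → Finset (B7Prop1Explicit.Site d × Fin d)) (w : ℕ → B7Prop1Explicit.Site d × Fin d → ℝ)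
  (K : ℕ → B7Prop1Explicit.Site d × Fin d → 𝔸)

variable {ι : Type} [Fintype ι] [DecidableEq ι] (e : ι → 𝔸) (τ : 𝔸 →L[ℝ] ℝ)
variable {g : B6.Geometry} (blk : S × ι → g.Site)
variable {n m q : Type} [Fintype n] [Fintype m] [Fintype q] [DecidableEq n] [DecidableEq m]
variable {P : Type} [AddCommGroup P] [Module ℝ P]

/-- §1's pair map IS §2's word: `((KD)(G′RD*), (RG′D*)K·T) = ((mulVecLin (K·D)) ∘ (mulVecLin (G′·R·Dᵀ)), (mulVecLin (R·G′)) ∘ (mulVecLin (Dᵀ·K)) ∘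
(mulVecLin T))`. [cite: Balaban1985BackgroundPropagators, (3.120) p.419, (3.130) p.421] -/
theorem T1_matrix_eq {X : Type} [Fintype X] [DecidableEq X] (Kb : Matrix X X ℝ) (Δ : Matrix n n ℝ) (Q : Matrix m n ℝ) (a : ℝ)
    (D : Matrix X n ℝ) :
    (Matrix.mulVecLin (Kb * D * (B9H163.G' Δ Q a * B9H163.R Δ Q a * Dᵀ))).prod
        (Matrix.mulVecLin (B9H163.R Δ Q a * B9H163.G' Δ Q a * Dᵀ * Kb * B9SectDFP.tOp Δ Q a D)) =
      (Matrix.mulVecLin (Kb * D) ∘ₗ Matrix.mulVecLin (B9H163.G' Δ Q a * B9H163.R Δ Q a * Dᵀ)).prod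
        (Matrix.mulVecLin (B9H163.R Δ Q a * B9H163.G' Δ Q a) ∘ₗ
          (Matrix.mulVecLin (Dᵀ * Kb) ∘ₗ Matrix.mulVecLin (B9SectDFP.tOp Δ Q a D))) := by
  rw [← Matrix.mulVecLin_mul, ← Matrix.mulVecLin_mul, ← Matrix.mulVecLin_mul]
  congr 2
  simp only [Matrix.mul_assoc]

include hL hG hU₀ hα hα3 hα4 h52 hb hsmall hc₃ h145 h155 in
/-- **THEOREM 3.12's CLAUSE «THEOREM 3.11 HOLDS FOR G₁», the `Δ′_π` step EXPLICIT**: `K` symmetric (the form `Δ` of ⟨A,ΔA⟩), `Δ` symmetric,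
`Δ_a = K + DRD* + aQ_bᵀQ_b > 0` (Theorem 3.11; `G₀ := Δ_a⁻¹`), the Theorem 3.3 letters of `G₀`, `G₀D`, the Theorem 3.1 ∘ (3.49) letters of `T`,
`RG′D*`, `G′RD*`, `RG′`, the (3.117) letters of `K·D`, `D*·K` (`c_J·Mα₀`, `c_J′·Mα₀`: «the error terms are small because the function J … is
small»), [5]'s concrete `Δ⁽²⁾`, all letters at the rate `δ₁` with `5σ ≤ δ₁`, `3σ ≤ δ_G`, and the smallness `Mα₀·D ≤ ½`,
`D = max(1,κ_P)(B_G + B′_G)(c₁ + c₂)c_r²`, `c₁ = κ_P c_J B_W c_r + κ_P B_R c_J′ C_T c_r²`, `c₂ = θ₀e^{(δ₁−σ)R}C_Tc_r(1 + B₁c_r)` ⟹ with `𝒞 := ½Δ⁽²⁾`: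
`G1inv K 𝒞 …` is invertible, `(G1inv …)⁻¹ > 0`, `G1inv … > 0`, and `Σ_n G₀((Δ′_π + Δ⁽²⁾_π)G₀)ⁿ` converges to `(G1inv …)⁻¹` in the sup operator norm —
r06 FILE 81's `thm312_posDef_G1_assembled` with its hypotheses `h1` (§1 `step1_factored`) and `hT1` (§2 `hasMaj_T1'`) DISCHARGED.
[cite: Balaban1985BackgroundPropagators, Thm 3.12 p.423, (3.138) p.423, (3.130) p.421, (3.117)–(3.120) p.419, Thm 3.11 p.416, (3.128) p.421]
[cite: Balaban1984PropagatorsII, (2.52)–(2.55) p.232, (2.61) p.234] [cite: Balaban1985Averaging, (149) p.40] -/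
theorem thm312_posDef_G1_step1 (hd : 2 ≤ d) (hJ : ∀ j ∈ lv, j ≤ k) (hw : ∀ j ∈ lv, ∀ c ∈ T j, 0 ≤ w j c)
    {c₀ M Me : ℝ} (hc₀ : 0 ≤ c₀) (hM : 0 ≤ M) (hMe : 0 ≤ Me) (he : ∀ i, ‖e i‖ ≤ Me)
    (hK : ∀ j ∈ lv, ∀ c ∈ T j, w j c * ‖K j c‖ ≤ c₀ * M * α₀ * ((L : ℝ) ^ j) ^ (d - 2))
    {R : ℝ} (hR : ∀ j ∈ lv, ∀ c ∈ T j, ∀ y y' : g.Site, BoxMeets L S blk j c y → BoxMeets L S blk j c y' → g.dist y y' ≤ R)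
    (Kb : Matrix (S × ι) (S × ι) ℝ) (hKb : Kbᵀ = Kb) (Δ : Matrix n n ℝ) (hΔ : Δ.IsSymm) (Q : Matrix m n ℝ) (a : ℝ) (D : Matrix (S × ι) n ℝ)
    (Qb : Matrix q (S × ι) ℝ) (ab : ℝ) (hΔa : (Kb + D * B9H163.R Δ Q a * Dᵀ + ab • (Qbᵀ * Qb)).PosDef)
    {bP : BlockNorm g (n → ℝ)} {cJ cJ' BW BR CT B₁ BG BG' δ₁ δG σ cr : ℝ}
    (htri : B6RandomWalk.Triangle254 g) (hdist : ∀ y y' : g.Site, 0 ≤ g.dist y y') (hrow : RowSum g σ cr) (hcr : 0 ≤ cr)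
    (hcJ : 0 ≤ cJ) (hcJ' : 0 ≤ cJ') (hBW : 0 ≤ BW) (hBR : 0 ≤ BR) (hCT : 0 ≤ CT) (hB₁ : 0 ≤ B₁) (hBG : 0 ≤ BG) (hBG' : 0 ≤ BG')
    (hσ : 0 ≤ σ) (hσ₁ : 5 * σ ≤ δ₁) (hσG : 3 * σ ≤ δG)
    (hJ1 : HasMaj bP (BlockNorm.ofBlocks g blk) (Matrix.mulVecLin (Kb * D))
      (fun y y' => cJ * (M * α₀) * Real.exp (-(δ₁ * g.dist y y'))))
    (hJt : HasMaj (BlockNorm.ofBlocks g blk) bP (Matrix.mulVecLin (Dᵀ * Kb))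
      (fun y y' => cJ' * (M * α₀) * Real.exp (-(δ₁ * g.dist y y'))))
    (hW : HasMaj (BlockNorm.ofBlocks g blk) bP (Matrix.mulVecLin (B9H163.G' Δ Q a * B9H163.R Δ Q a * Dᵀ))
      (fun y y' => BW * Real.exp (-(δ₁ * g.dist y y'))))
    (hRGp : HasMaj bP bP (Matrix.mulVecLin (B9H163.R Δ Q a * B9H163.G' Δ Q a))
      (fun y y' => BR * Real.exp (-(δ₁ * g.dist y y'))))
    (hT : HasMaj (BlockNorm.ofBlocks g blk) (BlockNorm.ofBlocks g blk) (Matrix.mulVecLin (B9SectDFP.tOp Δ Q a D))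
      (fun y y' => CT * Real.exp (-(δ₁ * g.dist y y'))))
    (hRG : HasMaj (BlockNorm.ofBlocks g blk) bP (Matrix.mulVecLin (B9H163.R Δ Q a * B9H163.G' Δ Q a * Dᵀ))
      (fun y y' => B₁ * Real.exp (-(δ₁ * g.dist y y'))))
    (hG0 : HasMaj (BlockNorm.ofBlocks g blk) (BlockNorm.ofBlocks g blk)
      (Matrix.mulVecLin (Kb + D * B9H163.R Δ Q a * Dᵀ + ab • (Qbᵀ * Qb))⁻¹) (fun y y' => BG * Real.exp (-(δG * g.dist y y'))))
    (hG0D : HasMaj bP (BlockNorm.ofBlocks g blk) (Matrix.mulVecLin ((Kb + D * B9H163.R Δ Q a * Dᵀ + ab • (Qbᵀ * Qb))⁻¹ * D))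
      (fun y y' => BG' * Real.exp (-(δG * g.dist y y'))))
    (hsm : M * α₀ * (max 1 bP.κ * (BG + BG') * ((bP.κ * cJ * BW * cr + bP.κ * BR * cJ' * CT * cr * cr) +
        (2 * d * C3Gen d L * ‖τ‖ * (∑ i, ‖e i‖) * Me * c₀ * lv.card) * Real.exp ((δ₁ - σ) * R) * CT * cr * (1 + B₁ * cr)) * cr * cr)
        ≤ 1 / 2) :
    IsUnit (B9Eq3152.G1inv Kb ((1 / 2 : ℝ) • B9Delta2Def134.delta2 (calC L U₀ S lv T w K e τ)) Δ Q a D Qb ab).det ∧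
    ((B9Eq3152.G1inv Kb ((1 / 2 : ℝ) • B9Delta2Def134.delta2 (calC L U₀ S lv T w K e τ)) Δ Q a D Qb ab)⁻¹).PosDef ∧
    (B9Eq3152.G1inv Kb ((1 / 2 : ℝ) • B9Delta2Def134.delta2 (calC L U₀ S lv T w K e τ)) Δ Q a D Qb ab).PosDef ∧
    HasSum (fun n : ℕ => (Kb + D * B9H163.R Δ Q a * Dᵀ + ab • (Qbᵀ * Qb))⁻¹ *
        (((Kb - B9SectDFP.piOp Kb Δ Q a D) + B9Delta2Def134.delta2pi (calC L U₀ S lv T w K e τ) Δ Q a D) *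
          (Kb + D * B9H163.R Δ Q a * Dᵀ + ab • (Qbᵀ * Qb))⁻¹) ^ n)
      (B9Eq3152.G1inv Kb ((1 / 2 : ℝ) • B9Delta2Def134.delta2 (calC L U₀ S lv T w K e τ)) Δ Q a D Qb ab)⁻¹ := by
  have hMα : 0 ≤ M * α₀ := mul_nonneg hM hα.le
  have hκX : (BlockNorm.ofBlocks g blk).κ = 1 := rfl
  -- §2: the majorant of the explicit `𝒯₁` at the rate `δ₁ − σ`
  have hT1 := hasMaj_T1' (ρ := δ₁ - σ) htri hdist hrow hcJ hcJ' hMα hBW hBR hCT (by linarith) hσ (by linarith) hJ1 hJt hW hRGp hT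
  rw [hκX, mul_one, ← T1_matrix_eq Kb Δ Q a D] at hT1
  -- FILE 81 at `δ_T := δ₁ − σ` (the letters `T`, `RG′D*` weakened to that rate)
  have hT' := hT.of_rate_le hdist hCT (show δ₁ - σ ≤ δ₁ by linarith)
  have hRG' := hRG.of_rate_le hdist hB₁ (show δ₁ - σ ≤ δ₁ by linarith)
  have hc₁ : 0 ≤ bP.κ * cJ * BW * cr + bP.κ * BR * cJ' * CT * cr * cr := by
    have := bP.κ_nonneg
    positivity
  exact B9Thm312PositivityAssembled.thm312_posDef_G1_assembled L hL hG k U₀ hU₀ hα hα3 hα4 h52 hb hsmall hc₃ h145 h155 S lv T w K e τ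
    blk hd hJ hw hc₀ hM hMe he hK hR Kb hKb Δ hΔ Q a D Qb ab hΔa htri hdist hrow hcr hc₁ hCT hB₁ hBG hBG' hσ (by linarith) hσG
    (step1_factored _ Kb Δ Q a D hΔ) hT1 hT' hRG' hG0 hG0D hsm

end Assembled

/-! ## §4 (v1.1) The `𝒯₁`-majorant from an abstract STATE norm, and Theorem 3.12's right entries of `G₁` with the `Δ′_π` step explicit -/

section StateNorm

variable {g : B6.Geometry} {FC FX P : Type} [AddCommGroup FC] [Module ℝ FC] [AddCommGroup FX] [Module ℝ FX]
  [AddCommGroup P] [Module ℝ P]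
variable {bC : BlockNorm g FC} {bX : BlockNorm g FX} {bP : BlockNorm g P}

/-- **the `𝒯₁`-majorant from an abstract state norm `bC`** (pub-balaban r1's sup ⊕ Hölder state of `B9SectDSup`, or any other): the letters
`KD : bP → bX`, `D*K : bX → bP` ((3.117), `c_J·m`, `c_J′·m`), `G′RD* : bC → bP` (`B_W`), `RG′ : bP → bP` (`B_R`), `T : bC → bX` (`C_T`), all at the
rate `δ₁` ⟹ `𝒯₁ = ((KD)(G′RD*), (RG′)(D*K)T) : bC → bX × bP` has `(κ_P c_J B_W c + κ_P B_R κ_X c_J′ C_T c²)·m·e^{−ρd}`, `ρ + σ ≦ δ₁` — §2 with the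
SOURCE norm decoupled from the bond norm `bX`, so that the state norm may carry print's `|D*A|`/Hölder sizes ((3.131), (3.43)).
[cite: Balaban1985BackgroundPropagators, (3.120) p.419, (3.130)–(3.131) pp.421–422] [cite: Balaban1984PropagatorsII, (2.52)–(2.55) p.232, (2.61) p.234] -/
theorem hasMaj_T1_src {J : P →ₗ[ℝ] FX} {W : FC →ₗ[ℝ] P} {RG : P →ₗ[ℝ] P} {Jt : FX →ₗ[ℝ] P} {Top : FC →ₗ[ℝ] FX}
    {cJ cJ' m BW BR CT δ₁ ρ σ c : ℝ}
    (htri : Triangle254 g) (hd : ∀ a b : g.Site, 0 ≤ g.dist a b) (hrow : RowSum g σ c)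
    (hcJ : 0 ≤ cJ) (hcJ' : 0 ≤ cJ') (hm : 0 ≤ m) (hBW : 0 ≤ BW) (hBR : 0 ≤ BR) (hCT : 0 ≤ CT) (hρ : 0 ≤ ρ) (hσ : 0 ≤ σ)
    (hρδ : ρ + σ ≤ δ₁)
    (hJ : HasMaj bP bX J (fun a b => cJ * m * Real.exp (-(δ₁ * g.dist a b))))
    (hJt : HasMaj bX bP Jt (fun a b => cJ' * m * Real.exp (-(δ₁ * g.dist a b))))
    (hW : HasMaj bC bP W (fun a b => BW * Real.exp (-(δ₁ * g.dist a b))))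
    (hRG : HasMaj bP bP RG (fun a b => BR * Real.exp (-(δ₁ * g.dist a b))))
    (hT : HasMaj bC bX Top (fun a b => CT * Real.exp (-(δ₁ * g.dist a b)))) :
    HasMaj bC (prodNorm bX bP) ((J ∘ₗ W).prod (RG ∘ₗ (Jt ∘ₗ Top)))
      (fun a b => (bP.κ * cJ * BW * c + bP.κ * BR * bX.κ * cJ' * CT * c * c) * m * Real.exp (-(ρ * g.dist a b))) := by
  have hc : 0 ≤ c ∨ IsEmpty g.Site := by
    by_cases hne : Nonempty g.Site
    · exact Or.inl (hrow.nonneg (Classical.arbitrary _))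
    · exact Or.inr (not_nonempty_iff.mp hne)
  rcases hc with hc | hemp
  swap
  · intro y' μ hμ y
    exact (IsEmpty.false y).elim
  have hcJm : 0 ≤ cJ * m := mul_nonneg hcJ hm
  have hcJ'm : 0 ≤ cJ' * m := mul_nonneg hcJ' hm
  have h1 : HasMaj bC bX (J ∘ₗ W) (fun a b => bP.κ * (cJ * m) * BW * c * Real.exp (-(ρ * g.dist a b))) :=
    hasMaj_comp_exp htri hd hrow hcJm hBW hρ (by linarith) hρδ hJ hW
  have h2 : HasMaj bC bP (Jt ∘ₗ Top) (fun a b => bX.κ * (cJ' * m) * CT * c * Real.exp (-(ρ * g.dist a b))) :=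
    hasMaj_comp_exp htri hd hrow hcJ'm hCT hρ (by linarith) hρδ hJt hT
  have h3 : HasMaj bC bP (RG ∘ₗ (Jt ∘ₗ Top))
      (fun a b => bP.κ * BR * (bX.κ * (cJ' * m) * CT * c) * c * Real.exp (-(ρ * g.dist a b))) :=
    hasMaj_comp_exp htri hd hrow hBR (mul_nonneg (mul_nonneg (mul_nonneg bX.κ_nonneg hcJ'm) hCT) hc) hρ le_rfl hρδ hRG h2
  exact (hasMaj_prod h1 h3).mono fun a b => le_of_eq (by ring)

end StateNorm

section RightEntries

open NormedSpace Finset Metric Filter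
open B7Prop1Explicit B7Prop1Local B7Prop2Explicit B7Prop3Flat B7Prop4Flat B7Eq92Concrete B7Prop3GeneralLinear
  B7Prop4GeneralLevels B7Prop5GeneralOperators B7Prop5GeneralInduction B7Prop5GeneralLevels B7Ineq149Pairing B7Eq136SecondOrder
  B9Ineq3137From149 B9Eq3134MatrixConcrete

variable {d : ℕ}
variable {𝔸 : Type*} [NormedRing 𝔸] [NormedAlgebra ℂ 𝔸] [CompleteSpace 𝔸] [NormOneClass 𝔸]

variable (L : ℕ) (hL : 2 ≤ L) {G : Subgroup 𝔸ˣ} (hG : AvgClosed d L G) (k : ℕ)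
  (U₀ : B7Prop1Explicit.Site d → Fin d → 𝔸ˣ) (hU₀ : ∀ x κ, U₀ x κ ∈ G) {α₀ : ℝ} (hα : 0 < α₀)
  (hα3 : C0 d * α₀ ≤ 1 / 3) (hα4 : 4 * α₀ ≤ c2' d L) (h52 : pdev U₀ < α₀ * (((L : ℝ) ^ k)⁻¹) ^ 2)
  {b : ℝ} (hb : 0 < b)
  (hsmall : Real.exp (4 * (800 * ((d : ℝ) + 1) ^ 2 * ((d : ℝ) + 4)) * α₀)
    * (1 + 8 * (131072 * ((d : ℝ) + 1) ^ 2) * ((L : ℝ) ^ k * b)) ≤ 2)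
  (hc₃ : 4 * ((L : ℝ) ^ k * b) < c3 d L)
  (h145 : 8 * d * thetaGen d L α₀ * (L : ℝ)⁻¹ ^ 4 ≤ 1)
  (h155 : (2 * (L : ℝ) - 1) * (L : ℝ)⁻¹ ^ 2 + 2 * d * thetaGen d L α₀ * (L : ℝ)⁻¹ ^ 3
    + 1 / 8 * (1 + 2 * d * thetaGen d L α₀ * (L : ℝ)⁻¹ ^ 2 + 2 * d * C3Gen d L * ((L : ℝ) ^ k * b)) * (L : ℝ)⁻¹ ^ 2 ≤ 1)
  (S : Finset (B7Prop1Explicit.Site d × Fin d))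
  (lv : Finset ℕ) (T : ℕ → Finset (B7Prop1Explicit.Site d × Fin d)) (w : ℕ → B7Prop1Explicit.Site d × Fin d → ℝ)
  (K : ℕ → B7Prop1Explicit.Site d × Fin d → 𝔸)

variable {ι : Type} [Fintype ι] [DecidableEq ι] (e : ι → 𝔸) (τ : 𝔸 →L[ℝ] ℝ)
variable {g : B6.Geometry} (blk : S × ι → g.Site)
variable {n m : Type} [Fintype n] [Fintype m] [DecidableEq n] [DecidableEq m]
variable {F₀ : Type} [AddCommGroup F₀] [Module ℝ F₀]

include hL hG hU₀ hα hα3 hα4 h52 hb hsmall hc₃ h145 h155 in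
/-- **THEOREM 3.12's RIGHT ENTRIES OF `G₁` WITH THE `Δ′_π` STEP EXPLICIT** («the series (3.138) is convergent for α₀ restricted by a small, absolute
constant … This implies that the theorem is valid for G₁», the entries reachable from a STATE norm `bC`): r06 FILE 78's
`B9Eq3138StepDelta2Pi.thm312_G1_rightEntry_concreteDelta2` with `Δ′_π := K − TᵀKT`, its hypothesis `h1` DISCHARGED by `step1_factored` and `hT1`
DERIVED by `hasMaj_T1_src` from the letters `K·D : bP → bX` (`c_J·Mα₀`), `Dᵀ·K : bX → bP` (`c_J′·Mα₀`) ((3.117)), `G′·R·Dᵀ : bC → bP` (`B_W`), `R·G′ :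
bP → bP` (`B_R`) and FILE 78's `T : bC → bX`, `R·G′·Dᵀ : bX → bP`, `G₀`, `G₀D`, `G₀F`, the matrix resolvent form `G₁ = G₀ + G₀(Δ′_π + Δ⁽²⁾_π)G₁`, an
a-priori bound, all letters at `δ_T` with `ρ + 4σ ≦ δ_T`, and the smallness `Mα₀ ≦ (2D)⁻¹` (`D` explicit, `c₁ = κ_P c_J B_W c_r + κ_P B_R c_J′ C_T c_r²`)
⟹ `G₁F : b₀ → bC` has `2A·e^{−ρd}` (`bX` = the sharp-block sup sizes of the bond coordinates).
[cite: Balaban1985BackgroundPropagators, Thm 3.12 p.423, (3.138) p.423, (3.130) p.421, (3.117)–(3.120) p.419]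
[cite: Balaban1984PropagatorsII, (2.52)–(2.55) p.232, (2.61) p.234] [cite: Balaban1985Averaging, (149) p.40] -/
theorem thm312_G1_rightEntry_step1 (hd : 2 ≤ d) (hJ : ∀ j ∈ lv, j ≤ k) (hw : ∀ j ∈ lv, ∀ c ∈ T j, 0 ≤ w j c)
    {c₀ M Me : ℝ} (hc₀ : 0 ≤ c₀) (hM : 0 ≤ M) (hMe : 0 ≤ Me) (he : ∀ i, ‖e i‖ ≤ Me)
    (hK : ∀ j ∈ lv, ∀ c ∈ T j, w j c * ‖K j c‖ ≤ c₀ * M * α₀ * ((L : ℝ) ^ j) ^ (d - 2))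
    {R : ℝ} (hR : ∀ j ∈ lv, ∀ c ∈ T j, ∀ y y' : g.Site, BoxMeets L S blk j c y → BoxMeets L S blk j c y' → g.dist y y' ≤ R)
    (G1m G0m Kb : Matrix (S × ι) (S × ι) ℝ) (Δ : Matrix n n ℝ) (hΔ : Δ.IsSymm) (Q : Matrix m n ℝ) (a : ℝ) (D : Matrix (S × ι) n ℝ)
    (hfixm : G1m = G0m + G0m * ((Kb - B9SectDFP.piOp Kb Δ Q a D) + B9Delta2Def134.delta2pi (calC L U₀ S lv T w K e τ) Δ Q a D) * G1m)
    {bC : BlockNorm g (S × ι → ℝ)} {bP : BlockNorm g (n → ℝ)} {b₀ : BlockNorm g F₀} {Fop : F₀ →ₗ[ℝ] (S × ι → ℝ)}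
    {cJ cJ' BW BR CT B₁ BG BG' A M₀ δT δG ρS ρ σ cr : ℝ}
    (htri : B6RandomWalk.Triangle254 g) (hdist : ∀ y y' : g.Site, 0 ≤ g.dist y y') (hrow : RowSum g σ cr) (hcr : 0 ≤ cr)
    (hcJ : 0 ≤ cJ) (hcJ' : 0 ≤ cJ') (hBW : 0 ≤ BW) (hBR : 0 ≤ BR) (hCT : 0 ≤ CT) (hB₁ : 0 ≤ B₁) (hBG : 0 ≤ BG) (hBG' : 0 ≤ BG')
    (hA : 0 ≤ A) (hM₀ : 0 ≤ M₀) (hρ : 0 ≤ ρ) (hσ : 0 ≤ σ) (hρS : ρ ≤ ρS) (hρT : ρ + 4 * σ ≤ δT) (hρG : ρ + 2 * σ ≤ δG)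
    (hJ1 : HasMaj bP (BlockNorm.ofBlocks g blk) (Matrix.mulVecLin (Kb * D))
      (fun y y' => cJ * (M * α₀) * Real.exp (-(δT * g.dist y y'))))
    (hJt : HasMaj (BlockNorm.ofBlocks g blk) bP (Matrix.mulVecLin (Dᵀ * Kb))
      (fun y y' => cJ' * (M * α₀) * Real.exp (-(δT * g.dist y y'))))
    (hW : HasMaj bC bP (Matrix.mulVecLin (B9H163.G' Δ Q a * B9H163.R Δ Q a * Dᵀ))
      (fun y y' => BW * Real.exp (-(δT * g.dist y y'))))
    (hRGp : HasMaj bP bP (Matrix.mulVecLin (B9H163.R Δ Q a * B9H163.G' Δ Q a))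
      (fun y y' => BR * Real.exp (-(δT * g.dist y y'))))
    (hT : HasMaj bC (BlockNorm.ofBlocks g blk) (Matrix.mulVecLin (B9SectDFP.tOp Δ Q a D))
      (fun y y' => CT * Real.exp (-(δT * g.dist y y'))))
    (hRG : HasMaj (BlockNorm.ofBlocks g blk) bP (Matrix.mulVecLin (B9H163.R Δ Q a * B9H163.G' Δ Q a * Dᵀ))
      (fun y y' => B₁ * Real.exp (-(δT * g.dist y y'))))
    (hG0 : HasMaj (BlockNorm.ofBlocks g blk) bC (Matrix.mulVecLin G0m) (fun y y' => BG * Real.exp (-(δG * g.dist y y'))))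
    (hG0D : HasMaj bP bC (Matrix.mulVecLin (G0m * D)) (fun y y' => BG' * Real.exp (-(δG * g.dist y y'))))
    (hS : HasMaj b₀ bC (Matrix.mulVecLin G0m ∘ₗ Fop) (fun y y' => A * Real.exp (-(ρS * g.dist y y'))))
    (hap : HasMaj b₀ bC (Matrix.mulVecLin G1m ∘ₗ Fop) (fun _ _ => M₀))
    (hsm : 0 < bC.κ * (max 1 bP.κ * (BG + BG') * ((bP.κ * cJ * BW * cr + bP.κ * BR * cJ' * CT * cr * cr) +
        (2 * d * C3Gen d L * ‖τ‖ * (∑ i, ‖e i‖) * Me * c₀ * lv.card) * Real.exp ((δT - σ) * R) * CT * cr * (1 + B₁ * cr)) * cr) * cr →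
      M * α₀ ≤ (2 * (bC.κ * (max 1 bP.κ * (BG + BG') * ((bP.κ * cJ * BW * cr + bP.κ * BR * cJ' * CT * cr * cr) +
        (2 * d * C3Gen d L * ‖τ‖ * (∑ i, ‖e i‖) * Me * c₀ * lv.card) * Real.exp ((δT - σ) * R) * CT * cr * (1 + B₁ * cr)) * cr) * cr))⁻¹) :
    HasMaj b₀ bC (Matrix.mulVecLin G1m ∘ₗ Fop) (fun y y' => 2 * A * Real.exp (-(ρ * g.dist y y'))) := by
  have hMα : 0 ≤ M * α₀ := mul_nonneg hM hα.le
  -- the explicit `𝒯₁` and its majorant at the rate `δT − σ`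
  have hT1 := hasMaj_T1_src (ρ := δT - σ) htri hdist hrow hcJ hcJ' hMα hBW hBR hCT (by linarith) hσ (by linarith) hJ1 hJt hW hRGp hT
  have hκX : (BlockNorm.ofBlocks g blk).κ = 1 := rfl
  rw [hκX, mul_one, ← T1_matrix_eq Kb Δ Q a D] at hT1
  -- FILE 78 §6 at `δ_T := δT − σ` (its letters `T`, `RG′D*` weakened to that rate)
  have hT' := hT.of_rate_le hdist hCT (show δT - σ ≤ δT by linarith)
  have hRG' := hRG.of_rate_le hdist hB₁ (show δT - σ ≤ δT by linarith)
  have hc₁ : 0 ≤ bP.κ * cJ * BW * cr + bP.κ * BR * cJ' * CT * cr * cr := by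
    have := bP.κ_nonneg
    positivity
  exact B9Eq3138StepDelta2Pi.thm312_G1_rightEntry_concreteDelta2 L hL hG k U₀ hU₀ hα hα3 hα4 h52 hb hsmall hc₃ h145 h155 S lv T w K e τ
    blk hd hJ hw hc₀ hM hMe he hK hR G1m G0m (Kb - B9SectDFP.piOp Kb Δ Q a D) Δ hΔ Q a D hfixm htri hdist hrow hcr hc₁ hCT hB₁ hBG hBG'
    hA hM₀ hρ hσ hρS (by linarith) hρG (step1_factored G0m Kb Δ Q a D hΔ) hT1 hT' hRG' hG0 hG0D hS hap hsm

end RightEntries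

end Literature.MathematicalPhysics.QuantumFieldTheory.Balaban1983to89.B9Eq3120StepDelta1Pi

end
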